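import Summits.QuantumFields.BalabanUV.T4Continuum.Support.NE3EnergyHessBilin
import Summits.QuantumFields.BalabanUV.T4Continuum.Support.NE3ProductPath
import Literature.MathematicalPhysics.QuantumFieldTheory.Balaban1983to89.T4TiltOscillation
import HarnessLib

/-!
# NE7HessAntisymmetricPart — THE ANTISYMMETRIC PART OF THE TREE's MIXED WILSON HESSIAN IS A FIRST VARIATION:
# `hess V X Y W − hess V Y X W = dAction V [X, Y] W` EXACTLY (bondwise commutator), hence `hess = hessSym + ½·dAction[·,·]` and, under the tension letter
# `|dAction V K| ≤ τ‖K‖₁`, `|hess V X Y W − hessSym V W X Y| ≤ τ·‖X‖_∞·‖Y‖₁` — (α) of the docking memo on OUR side: the tree's first-slot Hessian operator (F192's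
# `hessOpK`) differs from print's quadratic-form operator ([B9] (3.4)∕(3.9), F192's `hessSymOpK`) by a tension-sized term (file 124 of the curved (APE), F195)

Cell `pub-balaban`, rung (B)+1 sub-cell t4, lineage `b2b-balaban-t4-ne7-p1` (CRUX PROVER NE7 #1 = OWNER of row NE7), generation 85; memo
`t4/b2b-balaban-t4-ne7-p1-g85/LAGRANGE-CARRIER.md` §5.  Over `NE3HessForm` (`hess V X Y W = ∂_s∂_t A_W((V e^{sX}) e^{tY}) = Σ_p −Re tr[(dcurlAt V X Y + d_V Y·d_V X)·V(∂p)]∕n`,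
`dAction V K W = −Σ_p Re tr[d_V K · V(∂p)]∕n`), `NE3EnergyHessBilin.hessSym`, `NE3ProductPath.commutator_mem_skewAdjoint`, `T4TiltOscillation.nReTr_sub` BY NAME.
WHY.  By BCH, `e^{sX}e^{tY}` and `e^{tY}e^{sX}` differ at order `st` by `[X,Y]`, so the mixed second derivatives of the action along the two orders differ by the FIRST derivative
in the direction `[X,Y]`: `hess(X,Y) − hess(Y,X) = dA_V([X,Y])`.  THIS file proves it as an exact noncommutative-polynomial identity of the dressed curl and its derivative
(§1, per plaquette: `dcurl(X,Y) − dcurl(Y,X) + d_VY·d_VX − d_VX·d_VY = d_V[X,Y]`), so no second-order calculus is needed.  CONSEQUENCE for the docking: on a gauge-fixed slice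
solution `X″` the Lagrange form for the MIXED operator (F191∕F193) becomes the Lagrange form for the SYMMETRIC operator with the source shifted by the functional
`Y ↦ −½ dAction_W[X″, Y]`, bounded by `τ_W‖X″‖_∞‖Y‖₁` — a perturbation absorbed by the VALUE row of the constrained propagator (successor file).
WHAT ([folklore]; 0 def, 0 sorry).  §1 `dcurlAt_antisymm` (the matrix identity); §2 `hessPlaqAt_sub_swap`; §3 **`hess_sub_hess_swap`** (`hess V X Y W − hess V Y X W =
dAction V (fun y κ ↦ X y κ·Y y κ − Y y κ·X y κ) W`), `hess_eq_hessSym_add`; §4 `dirL1_comm_le` (`‖[X,Y]‖₁ ≤ 2‖X‖_∞‖Y‖₁`), `isSkewDir_comm`, `isPeriodicDir_comm`,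
**`abs_hess_sub_hessSym_le`** (`|hess V X Y W − hessSym V W X Y| ≤ τ·s·‖Y‖₁` from the tension letter on skew `P`-periodic fields, `‖X‖_∞ ≤ s`).
HONEST FRAMING (page 1): algebra + one triangle inequality; NO estimate of Bałaban's; the tension letter is a DISPLAYED HYPOTHESIS here (discharged elsewhere in the class by
`NE7TensionRadiusOfFluxGradient.abs_dAction_le_of_fluxGrad`, `τ = d·g_W + 12·#Plane·x²`); (KL-B) at curved `W` NOT proved; (APE) on curved data NOT proved; NOT ONE-STEP, NOT NE7;
spine 0∕9; finite T⁴ rung (B)+1 — NOT infinite volume, NOT mass gap, NOT `BetaPertH`, NOT Clay.  Continuum YM on T⁴ ⇐ BetaPertH ∧ nine spine estimates (0/9 proved); BetaPertH ⇐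
(D1) ∧ (D4) ∧ CAP+tail; G-an2-4 gates asym, D1 and NE2/3/4.
-/

set_option autoImplicit false

open scoped BigOperators Matrix.Norms.L2Operator
open Finset

namespace Summit.QuantumFields.BalabanUV.T4Continuum.NE7HessAntisymmetricPart

open Literature.MathematicalPhysics.QuantumFieldTheory.Balaban1983to89
open B7Prop1Explicit B7Prop2Explicit UnitaryModel
open T4AveragingDeficitWall (Ad IsSkewDir curlAt curl fhol dirL1)
open AveragingDeficitPeriodicCounting (IsPeriodicDir)
open NE3HessForm (dcurlAt dAction hessPlaqAt hessPlaq hess)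
open NE3EnergyHessBilin (hessSym hessSym_apply)
open NE3ProductPath (commutator_mem_skewAdjoint)

noncomputable section

variable {d : ℕ} {n : Type*} [Fintype n] [DecidableEq n]

/-! ## §1 The matrix identity: the antisymmetrised derivative of the dressed curl is the dressed curl of the commutator -/

/-- **`dcurl(X,Y) − dcurl(Y,X) + d_VY·d_VX − d_VX·d_VY = d_V[X,Y]`** at one plaquette — an identity of noncommutative polynomials in the bond variables, their inverses and
the two direction fields (the unit relations `V⁻¹V = 1` enter through `Units.inv_mul_cancel_left`). [folklore] -/
theorem dcurlAt_antisymm (V : Site d → Fin d → (Matrix n n ℂ)ˣ) (X Y : Site d → Fin d → Matrix n n ℂ) (z : Site d) (μ ν : Fin d) :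
    dcurlAt V X Y z μ ν - dcurlAt V Y X z μ ν + (curlAt V Y z μ ν * curlAt V X z μ ν - curlAt V X z μ ν * curlAt V Y z μ ν)
      = curlAt V (fun y κ => X y κ * Y y κ - Y y κ * X y κ) z μ ν := by
  simp only [dcurlAt, curlAt, Ad, Units.val_mul, mul_inv_rev, inv_inv, Units.val_mul]
  -- distribute and right-associate, cancelling adjacent `V⁻¹·V` ∕ `V·V⁻¹` pairs
  simp only [mul_sub, sub_mul, mul_add, add_mul, mul_assoc, Units.inv_mul_cancel_left, Units.mul_inv_cancel_left]
  abel

/-! ## §2 One plaquette of the Hessian -/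

/-- **ONE PLAQUETTE**: `hessPlaqAt V X Y − hessPlaqAt V Y X = −Re tr[d_V[X,Y](p′)·V(∂p′)]∕n`. [folklore] -/
theorem hessPlaqAt_sub_swap (V : Site d → Fin d → (Matrix n n ℂ)ˣ) (X Y : Site d → Fin d → Matrix n n ℂ) (z : Site d) (μ ν : Fin d) :
    hessPlaqAt V X Y z μ ν - hessPlaqAt V Y X z μ ν
      = -nReTr (curlAt V (fun y κ => X y κ * Y y κ - Y y κ * X y κ) z μ ν * ((hol V z (plaqWord μ ν) : (Matrix n n ℂ)ˣ) : Matrix n n ℂ)) := by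
  simp only [hessPlaqAt]
  rw [← dcurlAt_antisymm V X Y z μ ν, ← neg_sub, sub_neg_eq_add, neg_add_eq_sub, ← T4TiltOscillation.nReTr_sub, ← sub_mul]
  congr 2
  abel

/-! ## §3 The window sums: `hess(X,Y) − hess(Y,X) = dAction[X,Y]`, `hess = hessSym + ½ dAction[·,·]` -/

/-- **THE ANTISYMMETRIC PART OF THE MIXED HESSIAN IS A FIRST VARIATION**: `hess V X Y W − hess V Y X W = dAction V [X,Y] W` with the bondwise commutator
`[X,Y](y,κ) = X(y,κ)Y(y,κ) − Y(y,κ)X(y,κ)`. [folklore] -/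
theorem hess_sub_hess_swap (V : Site d → Fin d → (Matrix n n ℂ)ˣ) (X Y : Site d → Fin d → Matrix n n ℂ) (W : Finset (T4AveragingDeficitWall.Plaq d)) :
    hess V X Y W - hess V Y X W = dAction V (fun y κ => X y κ * Y y κ - Y y κ * X y κ) W := by
  simp only [hess, dAction, ← Finset.sum_sub_distrib, ← Finset.sum_neg_distrib]
  refine Finset.sum_congr rfl fun p _ => ?_
  exact hessPlaqAt_sub_swap V X Y p.1 p.2.1.1 p.2.1.2

/-- **`hess = hessSym + ½·dAction[·,·]`**: the tree's first-slot Hessian is print's symmetric Hessian plus half the first variation along the commutator. [folklore] -/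
theorem hess_eq_hessSym_add (V : Site d → Fin d → (Matrix n n ℂ)ˣ) (X Y : Site d → Fin d → Matrix n n ℂ) (W : Finset (T4AveragingDeficitWall.Plaq d)) :
    hess V X Y W = hessSym V W X Y + dAction V (fun y κ => X y κ * Y y κ - Y y κ * X y κ) W / 2 := by
  rw [hessSym_apply, ← hess_sub_hess_swap]
  ring

/-- The symmetric reading: `hessSym V W X Y = hess V X Y W − ½·dAction V [X,Y] W`. [folklore] -/
theorem hessSym_eq_hess_sub (V : Site d → Fin d → (Matrix n n ℂ)ˣ) (X Y : Site d → Fin d → Matrix n n ℂ) (W : Finset (T4AveragingDeficitWall.Plaq d)) :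
    hessSym V W X Y = hess V X Y W - dAction V (fun y κ => X y κ * Y y κ - Y y κ * X y κ) W / 2 := by
  rw [hess_eq_hessSym_add]; ring

/-! ## §4 Size under the tension letter -/

omit [DecidableEq n] in
/-- The bondwise commutator of skew fields is skew. [folklore] -/
theorem isSkewDir_comm {X Y : Site d → Fin d → Matrix n n ℂ} (hX : IsSkewDir X) (hY : IsSkewDir Y) :
    IsSkewDir (fun y κ => X y κ * Y y κ - Y y κ * X y κ) :=
  fun y κ => commutator_mem_skewAdjoint (hX y κ) (hY y κ)

omit [DecidableEq n] in
/-- The bondwise commutator of `P`-periodic fields is `P`-periodic. [folklore] -/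
theorem isPeriodicDir_comm {X Y : Site d → Fin d → Matrix n n ℂ} {P : ℤ} (hX : IsPeriodicDir X P) (hY : IsPeriodicDir Y P) :
    IsPeriodicDir (fun y κ => X y κ * Y y κ - Y y κ * X y κ) P := by
  intro y i κ
  show X (y + P • e i) κ * Y (y + P • e i) κ - Y (y + P • e i) κ * X (y + P • e i) κ = X y κ * Y y κ - Y y κ * X y κ
  rw [hX, hY]

/-- **`‖[X,Y]‖_{ℓ¹(B)} ≤ 2·‖X‖_∞·‖Y‖_{ℓ¹(B)}`**. [folklore] -/
theorem dirL1_comm_le {X Y : Site d → Fin d → Matrix n n ℂ} {s : ℝ} (hX : ∀ (y : Site d) (κ : Fin d), ‖X y κ‖ ≤ s) (B : Finset (Site d)) :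
    dirL1 (fun y κ => X y κ * Y y κ - Y y κ * X y κ) B ≤ 2 * s * dirL1 Y B := by
  unfold dirL1
  rw [Finset.mul_sum]
  refine Finset.sum_le_sum fun y _ => ?_
  rw [Finset.mul_sum]
  refine Finset.sum_le_sum fun κ _ => ?_
  have hs : 0 ≤ s := (norm_nonneg _).trans (hX y κ)
  calc ‖X y κ * Y y κ - Y y κ * X y κ‖ ≤ ‖X y κ * Y y κ‖ + ‖Y y κ * X y κ‖ := norm_sub_le _ _
    _ ≤ ‖X y κ‖ * ‖Y y κ‖ + ‖Y y κ‖ * ‖X y κ‖ := add_le_add (norm_mul_le _ _) (norm_mul_le _ _)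
    _ ≤ s * ‖Y y κ‖ + ‖Y y κ‖ * s := by gcongr <;> exact hX y κ
    _ = 2 * s * ‖Y y κ‖ := by ring

/-- **THE ANTISYMMETRIC PART IS TENSION-SIZED.**  Under the tension letter `|dAction V K W| ≤ τ·‖K‖_{ℓ¹(B)}` for skew `P`-periodic `K` (the END's `hten`; in the class
`τ = d·g_W + 12·#Plane·x²` by `NE7TensionRadiusOfFluxGradient`), for skew `P`-periodic `X`, `Y` with `‖X‖_∞ ≤ s`:
`|hess V X Y W − hessSym V W X Y| ≤ τ·s·‖Y‖_{ℓ¹(B)}`. [folklore] -/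
theorem abs_hess_sub_hessSym_le (V : Site d → Fin d → (Matrix n n ℂ)ˣ) (W : Finset (T4AveragingDeficitWall.Plaq d)) (B : Finset (Site d)) {P : ℤ} {τ : ℝ} (hτ : 0 ≤ τ)
    (hten : ∀ K : Site d → Fin d → Matrix n n ℂ, IsSkewDir K → IsPeriodicDir K P → |dAction V K W| ≤ τ * dirL1 K B)
    {X Y : Site d → Fin d → Matrix n n ℂ} (hXs : IsSkewDir X) (hXP : IsPeriodicDir X P) (hYs : IsSkewDir Y) (hYP : IsPeriodicDir Y P)
    {s : ℝ} (hX : ∀ (y : Site d) (κ : Fin d), ‖X y κ‖ ≤ s) :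
    |hess V X Y W - hessSym V W X Y| ≤ τ * s * dirL1 Y B := by
  have h1 : hess V X Y W - hessSym V W X Y = dAction V (fun y κ => X y κ * Y y κ - Y y κ * X y κ) W / 2 := by
    rw [hess_eq_hessSym_add]; ring
  rw [h1, abs_div, abs_two]
  have h2 := hten _ (isSkewDir_comm hXs hYs) (isPeriodicDir_comm hXP hYP)
  have h3 := dirL1_comm_le (Y := Y) hX B
  calc |dAction V (fun y κ => X y κ * Y y κ - Y y κ * X y κ) W| / 2
      ≤ τ * dirL1 (fun y κ => X y κ * Y y κ - Y y κ * X y κ) B / 2 := by gcongr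
    _ ≤ τ * (2 * s * dirL1 Y B) / 2 := by gcongr
    _ = τ * s * dirL1 Y B := by ring

end

end Summit.QuantumFields.BalabanUV.T4Continuum.NE7HessAntisymmetricPart
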